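import Summits.CriticalPhenomena.Ising3DConformalLimit.Theses.LocalisationClock
import Summits.CriticalPhenomena.Ising3DConformalLimit.Theorems.LeeYangGapGaussianLimitKillsBlockCoupling
import HarnessLib

/-!
# Line `twin-transfer` for the crux `LocalisationClock.GaussianLimitKillsBlockCoupling`
(item stmt-CriticalPhenomena-15886; crux-strategist planner-cstrat-stmt-CriticalPhenomena-15886-b1-0)

This "line" has NO stubs: it is the complete proof. The crux is byte-identical to the PROVED item
stmt-CriticalPhenomena-4950 of route LeeYangGap (the two route decls are `Iff.rfl`), so the in-tree term
`LeeYangGapGaussianLimitKillsBlockCoupling.gaussianLimitKillsBlockCoupling_proof` (Aizenman's dimension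
count for block sums, CDM 2020 §10.1: Ursell identity, near/far split with the Lebowitz–Griffiths
pairing bound, dyadic doubling of the axis two-point function from scale covariance, far smallness
from `U₄^S ≡ 0`) proves it verbatim. `lean check`: rc 0, 0 sorry, axioms {propext, Classical.choice,
Quot.sound}, audit `proof-of-item closed=true`.

LEAD / ANY PROVER: land the Theorems-shaped copy attached as item evidence
(`LocalisationClockGaussianLimitKillsBlockCoupling.lean`, namespace
`Summit.CriticalPhenomena.Ising3DConformalLimit.LocalisationClockGaussianLimitKillsBlockCoupling`) with
`ledger propose --kind proof --target
Summits/CriticalPhenomena/Ising3DConformalLimit/Theorems/LocalisationClockGaussianLimitKillsBlockCoupling.lean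
--file … --workitem stmt-CriticalPhenomena-15886`. A planner cannot (`perm.theorems-prover-only`).

## References
* M. Aizenman, CDM 2020 (arXiv:2112.04248), §10.1 [AizenmanCDM2020].
* M. Aizenman, H. Duminil-Copin, Ann. Math. 194 (2021), Prop. 1.4, eq. (3.12)
  [AizenmanDuminilCopinAnnals2021].
-/

namespace Summit.CriticalPhenomena.Ising3DConformalLimit.Cruxes.GaussianLimitKillsBlockCoupling.TwinTransfer

/-- The two route statements are one proposition (identical definientia). -/
theorem iff_twin :
    Summit.CriticalPhenomena.Ising3DConformalLimit.Theses.LocalisationClock.GaussianLimitKillsBlockCoupling ↔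
      Summit.CriticalPhenomena.Ising3DConformalLimit.Theses.LeeYangGap.GaussianLimitKillsBlockCoupling :=
  Iff.rfl

/-- **The crux BY NAME** — no stubs, no `sorry`: transfer of the twin item's in-tree proof. -/
theorem GaussianLimitKillsBlockCoupling_of :
    Summit.CriticalPhenomena.Ising3DConformalLimit.Theses.LocalisationClock.GaussianLimitKillsBlockCoupling :=
  iff_twin.2
    Summit.CriticalPhenomena.Ising3DConformalLimit.LeeYangGapGaussianLimitKillsBlockCoupling.gaussianLimitKillsBlockCoupling_proof

end Summit.CriticalPhenomena.Ising3DConformalLimit.Cruxes.GaussianLimitKillsBlockCoupling.TwinTransfer
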